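import Literature.MathematicalPhysics.QuantumFieldTheory.BalabanImbrieJaffe1984to88.BIJ88CutoffProfileWitness
import Mathlib.Analysis.Complex.ExponentialBounds

/-!
# `BalabanImbrieJaffe1984to88.BIJ88CutoffProfileConstants` — T. Bałaban, J. Imbrie, A. Jaffe, *Effective action and cluster
properties of the abelian Higgs model*, Commun. Math. Phys. **114** (1988) 257–315 [BalabanImbrieJaffe1988]: **(5.2.3)** p. 278 [PDF 22],
*"We let χ(1,x) be an even, C^∞ function, equal to zero for |x| ≥ 1, and equal to one for |x| ≤ 9/10, and with |dⁿχ(1,x)/dxⁿ| ≤ cⁿn^{cn}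
for all n, x"* — NUMBERS for the constant `c`.

statement-level skeleton of published theorems with citation tags; proofs where landed; nothing here is a claim about the Yang–Mills mass gap

WHAT THIS FILE ADDS (theorems only) to the typed carrier `BIJ88Sect5Statements.CutoffProfile` and to this seat's witness
`BIJ88CutoffProfileWitness.gevreyCutoff` (p269401):

* **§1 a lower bound valid for EVERY profile**: any constant `c` admissible in (5.2.3) satisfies `c ≥ 10` (`ten_le_of_deriv_bound`) — the
  profile drops from `1` at `x = 9/10` to `0` at `x = 1`, so by the mean value theorem `|χ′(1,ξ)| = 10` somewhere, while (5.2.3) at `n = 1`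
  reads `|χ′| ≤ c`.  In particular the printed `c` is never a small constant (`CutoffProfile.exists_const_ge_ten`).
* **§2 an explicit numerical constant for the witness**: the normalising integral `C = ∫₀¹ e^{−1/(y(1−y))}dy` of the Maynard–Pratt step obeys
  `C ≥ e^{−16/3}/2` (`half_exp_le_w0Const`: the integrand is `≥ e^{−16/3}` on `[1/4, 3/4]`), hence the witness's Gevrey constant
  `30(2/C + 1) ≤ 30(4e^{16/3} + 1) < 5·10⁴` (`witnessConst_lt`), and (5.2.3) holds for `gevreyCutoff` with the NUMERICAL constant `c = 5·10⁴`
  (`abs_iteratedDeriv_gevreyCutoff_le_numeric`, `exists_gevrey_cutoff_numeric`).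

PDF held: `paper:balaban1988-cmp114-bij-abelian-higgs-effective-action` (journal page = PDF page + 256); p. 278 [PDF 22].

CITATION HEADER (lean-in-tree rule).  Part of the lit-balaban TYPED SKELETON (HOME `run/shared/lean/pub/lit-balaban/`), Phase 2,
seat p36 (gen 7, unit `lit-balaban-p36`); row **C2.Eq5.2.1-5.2.4** of `HOME/lit-balaban-r16/ROWS-C2-part2.md` (owner r16), member (5.2.3).
Theorems only; no definitions, no `Prop` facts; axioms standard.
-/

namespace Literature.MathematicalPhysics.QuantumFieldTheory.BalabanImbrieJaffe1984to88.BIJ88CutoffProfileConstants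

open Literature.NumberTheory.LFunctions.MaynardPratt (w0Core w0Const w0Core_eq_exp w0Core_nonneg continuous_w0Core w0Const_pos)
open BIJ88Sect5Statements (CutoffProfile cutoff)
open BIJ88CutoffProfileWitness (chi1 gevreyCutoff)

/-! ## §1 Every admissible constant in (5.2.3) is at least `10` -/

section LowerBound

variable (χ : CutoffProfile)

/-- **`c ≥ 10` for every profile of (5.2.3).**  If `|χ^{(n)}(1,x)| ≤ cⁿn^{cn}` for all `n`, `x`, then `10 ≤ c`: by the mean value theorem
on `[9/10, 1]` (where χ(1,·) falls from `1` to `0`) there is `ξ` with `χ′(1,ξ) = −10`, and (5.2.3) at `n = 1` gives `|χ′(1,ξ)| ≤ c`.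
[cite: BalabanImbrieJaffe1988, (5.2.3) p.278] -/
theorem ten_le_of_deriv_bound {c : ℝ} (hc : ∀ (n : ℕ) (x : ℝ), |iteratedDeriv n χ.χ₁ x| ≤ c ^ n * (n : ℝ) ^ (c * n)) : 10 ≤ c := by
  have hdiff : Differentiable ℝ χ.χ₁ := (χ.smooth.of_le (by exact_mod_cast le_top : (1 : WithTop ℕ∞) ≤ _)).differentiable one_ne_zero
  obtain ⟨ξ, -, hξ⟩ := exists_deriv_eq_slope χ.χ₁ (show (9 / 10 : ℝ) < 1 by norm_num) hdiff.continuous.continuousOn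
    (hdiff.differentiableOn)
  have h1 : χ.χ₁ 1 = 0 := χ.eq_zero 1 (by norm_num)
  have h9 : χ.χ₁ (9 / 10) = 1 := χ.eq_one (9 / 10) (by rw [abs_of_pos (by norm_num)])
  rw [h1, h9] at hξ
  have hval : deriv χ.χ₁ ξ = -10 := by rw [hξ]; norm_num
  have h := hc 1 ξ
  rw [iteratedDeriv_one, hval, pow_one, Nat.cast_one, Real.one_rpow, mul_one] at h
  rw [abs_of_neg (by norm_num : (-10 : ℝ) < 0)] at h
  linarith

/-- The constant of (5.2.3) carried by a `CutoffProfile` can be chosen `≥ 10` — indeed every admissible one is.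
[cite: BalabanImbrieJaffe1988, (5.2.3) p.278] -/
theorem exists_const_ge_ten :
    ∃ c : ℝ, 10 ≤ c ∧ ∀ (n : ℕ) (x : ℝ), |iteratedDeriv n χ.χ₁ x| ≤ c ^ n * (n : ℝ) ^ (c * n) := by
  obtain ⟨c, hc⟩ := χ.deriv_bound
  exact ⟨c, ten_le_of_deriv_bound χ hc, hc⟩

/-- In particular `sup |χ′(1,·)| ≥ 10` for every profile: there is a point with `|χ′(1,ξ)| = 10`.
[cite: BalabanImbrieJaffe1988, (5.2.3) p.278] -/
theorem exists_abs_deriv_eq_ten : ∃ ξ : ℝ, 9 / 10 < ξ ∧ ξ < 1 ∧ |deriv χ.χ₁ ξ| = 10 := by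
  have hdiff : Differentiable ℝ χ.χ₁ := (χ.smooth.of_le (by exact_mod_cast le_top : (1 : WithTop ℕ∞) ≤ _)).differentiable one_ne_zero
  obtain ⟨ξ, hξm, hξ⟩ := exists_deriv_eq_slope χ.χ₁ (show (9 / 10 : ℝ) < 1 by norm_num) hdiff.continuous.continuousOn
    (hdiff.differentiableOn)
  have h1 : χ.χ₁ 1 = 0 := χ.eq_zero 1 (by norm_num)
  have h9 : χ.χ₁ (9 / 10) = 1 := χ.eq_one (9 / 10) (by rw [abs_of_pos (by norm_num)])
  rw [h1, h9] at hξ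
  refine ⟨ξ, hξm.1, hξm.2, ?_⟩
  rw [hξ]
  norm_num [abs_of_neg]

end LowerBound

/-! ## §2 A numerical Gevrey constant for the witness `gevreyCutoff` -/

section Numeric

/-- The bump integrand on the middle half: `e^{−16/3} ≤ h(y) = e^{−1/(y(1−y))}` for `y ∈ [1/4, 3/4]` (there `y(1−y) ≥ 3/16`).
[cite: BalabanImbrieJaffe1988, (5.2.3) p.278] -/
theorem exp_le_w0Core {y : ℝ} (hy : y ∈ Set.Icc (1 / 4 : ℝ) (3 / 4)) : Real.exp (-(16 / 3)) ≤ w0Core y := by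
  have h0 : 0 < y := by linarith [hy.1]
  have h1 : y < 1 := by linarith [hy.2]
  rw [w0Core_eq_exp h0 h1]
  refine Real.exp_le_exp.mpr ?_
  have hprod : 3 / 16 ≤ y * (1 - y) := by nlinarith [hy.1, hy.2]
  have hpos : 0 < y * (1 - y) := by positivity
  rw [neg_le_neg_iff, div_le_iff₀ hpos]
  nlinarith

/-- **`C ≥ e^{−16/3}/2`** for the normalising constant `C = ∫₀¹ e^{−1/(y(1−y))}dy` of the Maynard–Pratt step.
[cite: BalabanImbrieJaffe1988, (5.2.3) p.278] -/
theorem half_exp_le_w0Const : Real.exp (-(16 / 3)) / 2 ≤ w0Const := by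
  have hi : ∀ a b : ℝ, IntervalIntegrable w0Core MeasureTheory.volume a b := fun a b => continuous_w0Core.intervalIntegrable a b
  have hsplit : w0Const = (∫ x in (0 : ℝ)..(1 / 4), w0Core x) + ((∫ x in (1 / 4 : ℝ)..(3 / 4), w0Core x) +
      ∫ x in (3 / 4 : ℝ)..1, w0Core x) := by
    unfold w0Const
    rw [intervalIntegral.integral_add_adjacent_intervals (hi _ _) (hi _ _),
      intervalIntegral.integral_add_adjacent_intervals (hi _ _) (hi _ _)]
  have hA : 0 ≤ ∫ x in (0 : ℝ)..(1 / 4), w0Core x := intervalIntegral.integral_nonneg (by norm_num) fun u _ => w0Core_nonneg u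
  have hB : 0 ≤ ∫ x in (3 / 4 : ℝ)..1, w0Core x := intervalIntegral.integral_nonneg (by norm_num) fun u _ => w0Core_nonneg u
  have hM : Real.exp (-(16 / 3)) / 2 ≤ ∫ x in (1 / 4 : ℝ)..(3 / 4), w0Core x := by
    have hc : ∫ _ in (1 / 4 : ℝ)..(3 / 4), Real.exp (-(16 / 3)) = Real.exp (-(16 / 3)) / 2 := by
      rw [intervalIntegral.integral_const, smul_eq_mul]; ring
    rw [← hc]
    exact intervalIntegral.integral_mono_on (by norm_num) intervalIntegrable_const (hi _ _) fun y hy => exp_le_w0Core hy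
  rw [hsplit]
  linarith

/-- **The witness's Gevrey constant is `< 5·10⁴`**: `30(2/C + 1) ≤ 30(4e^{16/3} + 1) < 50000` (with `e^{16/3} ≤ e⁶ ≤ 2.72⁶`).
[cite: BalabanImbrieJaffe1988, (5.2.3) p.278] -/
theorem witnessConst_lt : 30 * (2 / w0Const + 1) < 50000 := by
  have hC := half_exp_le_w0Const
  have hE : 0 < Real.exp (-(16 / 3)) := Real.exp_pos _
  have hCpos : 0 < w0Const := w0Const_pos
  -- 2/C ≤ 4 e^{16/3}
  have h1 : 2 / w0Const ≤ 4 * Real.exp (16 / 3) := by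
    rw [div_le_iff₀ hCpos]
    have : Real.exp (16 / 3) * Real.exp (-(16 / 3)) = 1 := by rw [← Real.exp_add]; norm_num
    nlinarith
  -- e^{16/3} ≤ e^6 = (e^1)^6 < 2.7182818286^6 < 405
  have h2 : Real.exp (16 / 3) ≤ Real.exp 1 ^ 6 := by
    rw [← Real.exp_nat_mul]; exact Real.exp_le_exp.mpr (by norm_num)
  have h3 : Real.exp 1 ^ 6 < (2.7182818286 : ℝ) ^ 6 :=
    pow_lt_pow_left₀ Real.exp_one_lt_d9 (Real.exp_pos 1).le (by norm_num)
  have h4 : (2.7182818286 : ℝ) ^ 6 < 405 := by norm_num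
  linarith

/-- **(5.2.3) for the witness with a NUMERICAL constant**: `|gevreyCutoff^{(n)}(x)| ≤ (5·10⁴)ⁿ · n^{5·10⁴·n}` for all `n`, `x`.
[cite: BalabanImbrieJaffe1988, (5.2.3) p.278] -/
theorem abs_iteratedDeriv_gevreyCutoff_le_numeric (n : ℕ) (x : ℝ) :
    |iteratedDeriv n gevreyCutoff.χ₁ x| ≤ (50000 : ℝ) ^ n * (n : ℝ) ^ ((50000 : ℝ) * n) := by
  rw [BIJ88CutoffProfileWitness.gevreyCutoff_χ₁]
  -- the witness constant c₀ = 30(2/C+1) and monotonicity of c ↦ cⁿ n^{cn} in c (for c ≥ 1)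
  have hc0 : (1 : ℝ) ≤ 30 * (2 / w0Const + 1) := by
    have : 0 ≤ 2 / w0Const := by have := w0Const_pos; positivity
    nlinarith
  have hlt := witnessConst_lt
  -- the bound with c₀, from the witness file (re-derived from its two displayed steps)
  have hmain : |iteratedDeriv n chi1 x| ≤ (30 * (2 / w0Const + 1)) ^ n * (n : ℝ) ^ (30 * (2 / w0Const + 1) * n) := by
    rcases n with _ | k
    · simp only [iteratedDeriv_zero, pow_zero, Nat.cast_zero, mul_zero, Real.rpow_zero, mul_one]
      exact BIJ88CutoffProfileWitness.abs_chi1_le_one x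
    · refine (BIJ88CutoffProfileWitness.abs_iteratedDeriv_succ_chi1_le' k x).trans ?_
      have hK1 : (1 : ℝ) ≤ (k + 1 : ℕ) := by exact_mod_cast Nat.succ_le_succ (Nat.zero_le k)
      have hq : (1 : ℝ) ≤ 2 / w0Const + 1 := by
        have : 0 ≤ 2 / w0Const := by have := w0Const_pos; positivity
        linarith
      have hconst : 2 / w0Const * (30 : ℝ) ^ (k + 1) ≤ (30 * (2 / w0Const + 1)) ^ (k + 1) := by
        rw [mul_pow, mul_comm]
        refine mul_le_mul_of_nonneg_left ?_ (by positivity)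
        calc 2 / w0Const ≤ 2 / w0Const + 1 := by linarith
          _ ≤ (2 / w0Const + 1) ^ (k + 1) := le_self_pow₀ hq (Nat.succ_ne_zero k)
      have hexp : ((k + 1 : ℕ) : ℝ) ^ (2 * (k + 1)) ≤ ((k + 1 : ℕ) : ℝ) ^ (30 * (2 / w0Const + 1) * ((k + 1 : ℕ) : ℝ)) := by
        rw [← Real.rpow_natCast]
        refine Real.rpow_le_rpow_of_exponent_le hK1 ?_
        have hk0 : (0 : ℝ) ≤ ((k + 1 : ℕ) : ℝ) := Nat.cast_nonneg _
        push_cast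
        nlinarith
      exact mul_le_mul hconst hexp (by positivity) (by positivity)
  refine hmain.trans ?_
  -- monotonicity in the constant
  have hn0 : (0 : ℝ) ≤ n := Nat.cast_nonneg n
  have hpow : (30 * (2 / w0Const + 1)) ^ n ≤ (50000 : ℝ) ^ n := pow_le_pow_left₀ (by linarith) hlt.le n
  have hrpow : (n : ℝ) ^ (30 * (2 / w0Const + 1) * n) ≤ (n : ℝ) ^ ((50000 : ℝ) * n) := by
    rcases Nat.eq_zero_or_pos n with rfl | hn
    · simp
    · have hn1 : (1 : ℝ) ≤ n := by exact_mod_cast hn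
      exact Real.rpow_le_rpow_of_exponent_le hn1 (by nlinarith)
  exact mul_le_mul hpow hrpow (Real.rpow_nonneg hn0 _) (by positivity)

/-- **Non-vacuity of (5.2.3) with numbers**: there is an even `C^∞` profile, `= 1` on `|x| ≤ 9/10`, `= 0` on `|x| ≥ 1`, with
`|χ^{(n)}| ≤ cⁿn^{cn}` for the explicit constant `c = 5·10⁴` (and no admissible constant is below `10`).
[cite: BalabanImbrieJaffe1988, (5.2.3) p.278] -/
theorem exists_gevrey_cutoff_numeric :
    ∃ χ : ℝ → ℝ, (∀ x, χ (-x) = χ x) ∧ ContDiff ℝ (⊤ : ℕ∞) χ ∧ (∀ x, 1 ≤ |x| → χ x = 0) ∧ (∀ x, |x| ≤ 9 / 10 → χ x = 1) ∧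
      ∀ (n : ℕ) (x : ℝ), |iteratedDeriv n χ x| ≤ (50000 : ℝ) ^ n * (n : ℝ) ^ ((50000 : ℝ) * n) :=
  ⟨gevreyCutoff.χ₁, gevreyCutoff.even, gevreyCutoff.smooth, gevreyCutoff.eq_zero, gevreyCutoff.eq_one,
    abs_iteratedDeriv_gevreyCutoff_le_numeric⟩

end Numeric

end Literature.MathematicalPhysics.QuantumFieldTheory.BalabanImbrieJaffe1984to88.BIJ88CutoffProfileConstants
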